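import Summits.ResolutionOfSingularities.ResolutionOfSingularities.Theorems.HilbertSamuelEliminationSigmaMaxModificationsCorridor3WLadderHybridLowStrict
import Summits.ResolutionOfSingularities.ResolutionOfSingularities.Theorems.HilbertSamuelEliminationSigmaMaxModificationsCorridor3WLadderHybridLowReplay
import HarnessLib

/-!
# [OURS · L1 W4.2] `Corridor3WLadderHybridLowCycles` — CYCLE BOOKKEEPING of the menu hybrid `π.hybrid (ofStageOracleE ω)` under CYCLE ATOMICITY:
# the label invariant and the treated label along hybrid steps, the treated label inside a cycle, the END step blows up the treated part

Crux chain w42 (`SigmaMaxModifications`, stmt-ResolutionOfSingularities-18506; conjunct `SigmaMaxModificationsCorridor3`,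
stmt-ResolutionOfSingularities-19249), res-L1-w42-plan-1 RULINGS v3.14-22 (FW) β «policy steps emit `P' = none`», v3.14-35 (HR); res-L1-type-o1
15:21:10Z «CYCLE ATOMICITY: the policy is silent while a fallback cycle is pending» (`StrategyE.betweenCycles`). Typer res-type-040 (gen 19). PROOF
FILE (no definitions). OURS (cell res-hironaka, slot W4.2); NOT statements of H. Hironaka's manuscript [Hironaka2017] nor of [CossartJannsenSaito2020];
AI-typed, weaker than expert review. Helper file `--supports stmt-ResolutionOfSingularities-19249 --as helper` (counted 0).

Ports of stub-4's / brick 3b's cycle bookkeeping (`…WLadderStrataLabels`, `…WLadderStrataCycleStart`, `…SigmaStrataLabels`: `LabelInv.step`,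
`lbl_eq_treatedLabel`, `treatedLabel_le_of_step`, `treatedLabel_eq_of_cycle`, `support_eq_part_of_next_none`) to σE-chains of the hybrid, with the two
policy hypotheses `hπnone` (policy steps emit `none`) and `hπgate` (policy steps only from `P = none`):

* `step_fallback_of_pending` — under `hπgate` a hybrid step from a pending state is a fallback (`IsCanonicalStepΩE`) step;
* `lbl_eq_treatedLabel_hybrid` — a step with `P' = some Q'` is a fallback step and `Q'.lbl = treatedLabel`;
* `labelInv_step_hybrid`, `labelInv_of_reachesσE_hybrid` — `Moving.LabelInv` propagates along hybrid steps / `ReachesσE`;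
* `treatedLabel_le_of_step_hybrid` — the treated label does not decrease; `treatedLabel_eq_of_cycle_hybrid` — and is kept inside a cycle;
* `IsCanonicalStepΩE.support_eq_part_of_none` — a fallback step with `P' = none` (the END step) has centre the treated part `Y_n^{(j)}`.

Consumed by `…WLadderHybridLowRegular` ((c-reg) supplier). References: CJS LNM 2270 Rem. 6.29 (1) pp. 91–92, p. 102 [CossartJannsenSaito2020]; tree
`…WLadderHybridLowStrict` (p544207), `…WLadderHybridLowReplay` (p537833: `isCanonicalStepΩE_of_hybrid_of_ne_none`).
-/

noncomputable section

set_option linter.dupNamespace false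

open CategoryTheory AlgebraicGeometry TopologicalSpace Topology
open Summit.ResolutionOfSingularities.ResolutionOfSingularities.Theorems.CampaignW42
open Literature.AlgebraicGeometry.Resolution Literature.RingTheory.HilbertSamuel
open Literature.AlgebraicGeometry.CossartJannsenSaito2020
open Summit.ResolutionOfSingularities.ResolutionOfSingularities.Theorems.SigmaMaxModificationsCorridor3
open Summit.ResolutionOfSingularities.ResolutionOfSingularities.Theorems.SigmaMaxModificationsCorridor3.Moving

namespace Summit.ResolutionOfSingularities.ResolutionOfSingularities.Theorems.SigmaMaxModificationsCorridor3.Sigma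

universe u

variable {π : StrategyE.{u}} {ω : StageOracleE.{u}} {N : ℕ} {ν : ℕ → ℕ}

/-! ## §1. Hybrid cycle bookkeeping under cycle atomicity -/

section Bookkeeping

variable {s s' : MarkedStageE.{u}}
  (hπgate : ∀ (W : Scheme.{u}) (hW : IsLocallyNoetherian W) (L : Labelling W) (P : Option (Pending W)) (E : Boundary W)
    (C : W.IdealSheafData) (P' : Option (Pending (blowup C))), π.step W hW N ν L P E C P' → P = none)
  (hπnone : ∀ (W : Scheme.{u}) (hW : IsLocallyNoetherian W) (L : Labelling W) (P : Option (Pending W)) (E : Boundary W)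
    (C : W.IdealSheafData) (P' : Option (Pending (blowup C))), π.step W hW N ν L P E C P' → P' = none)

include hπgate in
/-- **Cycle atomicity**: under `hπgate` a hybrid step from a PENDING state (`P ≠ none`) is a fallback step. [cite: CossartJannsenSaito2020, Rem. 6.29 (1)] -/
theorem step_fallback_of_pending (hP : s.P ≠ none) {C : s.W.IdealSheafData} {P' : Option (Pending (blowup C))}
    (hcs : (π.hybrid (StrategyE.ofStageOracleE ω)).step s.W s.ln N ν s.L s.P s.E C P') : IsCanonicalStepΩE ω s.ln N ν s.L s.E s.P C P' := by
  rcases StrategyE.hybrid_step_cases hcs with hπs | hτs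
  · exact absurd (hπgate _ _ _ _ _ _ _ hπs) hP
  · exact hτs

include hπnone in
/-- **Inside a hybrid cycle the pending label is the treated label of the previous state** (a step with `P' = some Q'` is a fallback step; port
of `lbl_eq_treatedLabel_Ωplus`). [cite: CossartJannsenSaito2020, Rem. 6.29 (1)] -/
theorem lbl_eq_treatedLabel_hybrid (h : CanonicalNearStepσE (π.hybrid (StrategyE.ofStageOracleE ω)) N ν s s') {Q' : Pending s'.W}
    (h' : s'.P = some Q') : Q'.lbl = treatedLabel N ν s.toMarkedStage := by
  obtain ⟨C, P', hln, x', hcs, -, -, -, rfl⟩ := h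
  change P' = some Q' at h'
  have hτ : IsCanonicalStepΩE ω s.ln N ν s.L s.E s.P C P' :=
    isCanonicalStepΩE_of_hybrid_of_ne_none hπnone (by rw [h']; exact Option.some_ne_none Q') hcs
  rcases hsP : s.P with _ | Q
  · rw [treatedLabel_of_none (s := s.toMarkedStage) hsP]
    rw [hsP] at hτ
    obtain ⟨j, hj, hcl, t, -, hrep⟩ := hτ
    change Q'.lbl = sInf {i | (s.L.part (Scheme.hsStratum s.W N ν) i).Nonempty}
    rw [hj.csInf_eq]
    cases t with
    | nil _ =>
      obtain ⟨-, hnone⟩ := hrep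
      rw [hnone] at h'
      exact absurd h' (by simp)
    | cons D t' =>
      obtain ⟨-, φ', hφ', -, hsome⟩ := (isReplayStep_cons_iff _ _ _ _ D t' C P').mp hrep
      rw [hsome] at h'
      cases h'
      rfl
  · rw [treatedLabel_of_some (s := s.toMarkedStage) hsP]
    rw [hsP] at hτ
    obtain ⟨-, hrep⟩ := hτ
    generalize hr : Q.rest = r at hrep
    cases r with
    | nil _ =>
      obtain ⟨-, hnone⟩ := hrep
      rw [hnone] at h'
      exact absurd h' (by simp)
    | cons D t' =>
      obtain ⟨-, φ', hφ', -, hsome⟩ := (isReplayStep_cons_iff _ _ _ _ D t' C P').mp hrep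
      rw [hsome] at h'
      cases h'
      rfl

include hπnone in
/-- **The label invariant propagates along hybrid steps** (port of `labelInv_stepΩplus`; policy steps emit `none`, so the cycle clauses only
see fallback steps). [cite: CossartJannsenSaito2020, Rem. 6.29 (1)] -/
theorem labelInv_step_hybrid (hinv : LabelInv N ν s.toMarkedStage) (h : CanonicalNearStepσE (π.hybrid (StrategyE.ofStageOracleE ω)) N ν s s')
    (hne : (Scheme.hsStratum s.W N ν).Nonempty) : LabelInv N ν s'.toMarkedStage := by
  refine ⟨fun Z' => h.label_le_year hinv.label_le_year Z', fun Q' hQ' Z' hZ' => ?_, fun Q' hQ' => ?_⟩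
  · rw [lbl_eq_treatedLabel_hybrid hπnone h hQ']
    rcases h.label_cases Z' with hnew | ⟨Z, hZ, hold⟩
    · rw [hnew]
      exact (treatedLabel_le_year hinv hne).trans (Nat.le_succ _)
    · rw [hold]
      exact treatedLabel_le_label hinv hZ
  · rw [lbl_eq_treatedLabel_hybrid hπnone h hQ']
    rw [h.year_eq]
    exact (treatedLabel_le_year hinv hne).trans (Nat.le_succ _)

include hπnone in
/-- … and along `ReachesσE` (the marked points lying in the strata). [folklore] -/
theorem labelInv_of_reachesσE_hybrid {s₀ : MarkedStageE.{u}} (hinv₀ : LabelInv N ν s₀.toMarkedStage)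
    (hpt₀ : s₀.pt ∈ Scheme.hsStratum s₀.W N ν) (hr : ReachesσE (π.hybrid (StrategyE.ofStageOracleE ω)) N ν s₀ s) :
    LabelInv N ν s.toMarkedStage := by
  induction hr with
  | refl => exact hinv₀
  | tail hr' hlast ih => exact labelInv_step_hybrid hπnone ih hlast ⟨_, pt_mem_hsStratum_of_reachesσE hr' hpt₀⟩

include hπnone in
/-- **The treated label does not decrease along a hybrid step** (port of `treatedLabel_le_of_stepΩplus`). [cite: CossartJannsenSaito2020, Rem. 6.29 (1)] -/
theorem treatedLabel_le_of_step_hybrid (hinv : LabelInv N ν s.toMarkedStage)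
    (h : CanonicalNearStepσE (π.hybrid (StrategyE.ofStageOracleE ω)) N ν s s') (hne : (Scheme.hsStratum s.W N ν).Nonempty)
    (hne' : (Scheme.hsStratum s'.W N ν).Nonempty) : treatedLabel N ν s.toMarkedStage ≤ treatedLabel N ν s'.toMarkedStage := by
  rcases hs'P : s'.P with _ | Q'
  · rw [treatedLabel_of_none (s := s'.toMarkedStage) hs'P]
    have hS : {i | (s'.L.part (Scheme.hsStratum s'.W N ν) i).Nonempty}.Nonempty := by
      obtain ⟨y, hy⟩ := hne'
      obtain ⟨Z', hZ', -⟩ := componentsIn.exists_mem hy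
      exact ⟨_, part_label_nonempty s'.L hZ'⟩
    obtain ⟨y, hy⟩ := Nat.sInf_mem hS
    obtain ⟨Z', hZ', hl, -⟩ := (s'.L.mem_part_iff _ _ y).mp hy
    change treatedLabel N ν s.toMarkedStage ≤ sInf {i | (s'.L.part (Scheme.hsStratum s'.W N ν) i).Nonempty}
    rw [← hl]
    rcases h.label_cases Z' with hnew | ⟨Z, hZ, hold⟩
    · rw [hnew]
      exact (treatedLabel_le_year hinv hne).trans (Nat.le_succ _)
    · rw [hold]
      exact treatedLabel_le_label hinv hZ
  · rw [treatedLabel_of_some (s := s'.toMarkedStage) hs'P, lbl_eq_treatedLabel_hybrid hπnone h hs'P]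

include hπnone in
/-- **Inside a hybrid cycle the treated label is kept**: if `(c (m+1)).P ≠ none` for `r ≤ m < e`, then `treatedLabel (c e) = treatedLabel (c r)` (port
of stub-4's `treatedLabel_eq_of_cycle`). [cite: CossartJannsenSaito2020, Rem. 6.29 (1)] -/
theorem treatedLabel_eq_of_cycle_hybrid {c : ℕ → MarkedStageE.{u}}
    (hstep : ∀ n, CanonicalNearStepσE (π.hybrid (StrategyE.ofStageOracleE ω)) N ν (c n) (c (n + 1))) {r e : ℕ} (hre : r ≤ e)
    (hcyc : ∀ m, r ≤ m → m < e → (c (m + 1)).P ≠ none) :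
    treatedLabel N ν (c e).toMarkedStage = treatedLabel N ν (c r).toMarkedStage := by
  obtain ⟨d, rfl⟩ := Nat.exists_eq_add_of_le hre
  induction d with
  | zero => rfl
  | succ d ih =>
    have h1 : treatedLabel N ν (c (r + d)).toMarkedStage = treatedLabel N ν (c r).toMarkedStage :=
      ih (Nat.le_add_right r d) fun m hm hme => hcyc m hm (by omega)
    have hP : (c (r + d + 1)).P ≠ none := hcyc (r + d) (Nat.le_add_right r d) (by omega)
    obtain ⟨Q', hQ'⟩ := Option.ne_none_iff_exists'.mp hP
    rw [show r + (d + 1) = r + d + 1 by omega, treatedLabel_of_some (s := (c (r + d + 1)).toMarkedStage) hQ',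
      lbl_eq_treatedLabel_hybrid hπnone (hstep (r + d)) hQ', h1]

/-- **The END step of a fallback cycle blows up the treated part**: a fallback step with `P' = none` has centre `vanishingIdeal Y_n^{(j)}`,
`j = treatedLabel`, so its support IS the part. [cite: CossartJannsenSaito2020, Rem. 6.29 (1), p. 102] -/
theorem IsCanonicalStepΩE.support_eq_part_of_none {C : s.W.IdealSheafData} {P' : Option (Pending (blowup C))}
    (h : IsCanonicalStepΩE ω s.ln N ν s.L s.E s.P C P') (hP' : P' = none) :
    (C.support : Set s.W) = s.L.part (Scheme.hsStratum s.W N ν) (treatedLabel N ν s.toMarkedStage) := by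
  rcases hsP : s.P with _ | Q
  · rw [treatedLabel_of_none (s := s.toMarkedStage) hsP]
    rw [hsP] at h
    obtain ⟨j, hj, hcl, t, -, hrep⟩ := h
    rw [hj.csInf_eq]
    cases t with
    | nil _ => exact hrep.support_eq_part
    | cons D t' =>
      obtain ⟨-, φ', hφ', -, hsome⟩ := (isReplayStep_cons_iff _ _ _ _ D t' C P').mp hrep
      rw [hsome] at hP'
      exact absurd hP' (by simp)
  · rw [treatedLabel_of_some (s := s.toMarkedStage) hsP]
    rw [hsP] at h
    obtain ⟨-, hrep⟩ := h
    generalize hr : Q.rest = r at hrep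
    cases r with
    | nil _ => exact hrep.support_eq_part
    | cons D t' =>
      obtain ⟨-, φ', hφ', -, hsome⟩ := (isReplayStep_cons_iff _ _ _ _ D t' C P').mp hrep
      rw [hsome] at hP'
      exact absurd hP' (by simp)

end Bookkeeping

end Summit.ResolutionOfSingularities.ResolutionOfSingularities.Theorems.SigmaMaxModificationsCorridor3.Sigma

end
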